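import Mathlib
import Literature.NumberTheory.LFunctions.Zhang2022.TypedSection17
import HarnessLib

/-!
# Zhang (2022), §17: the displays (17.6) and (17.9) in the RELATIVE reading of record
# (`o(𝔓)` read `ε(𝔞+1)𝔓`; family ruling D-G-L4fam-1) — typed statements (readings), no proofs

Topic `Literature/NumberTheory/LFunctions/Zhang2022` (Landau–Siegel audit tree; verdict-neutral).
Y. Zhang, *Discrete mean estimates and the Landau–Siegel zero*, arXiv:2211.02515v1 (2022)
[Zhang2022LandauSiegel] — **an unrefereed manuscript under adjudication**. Companion READINGS of the
typed CLAIM nodes `Typed.Section17.Eq17_6` (17.6) and `Typed.Section17.Eq17_9` (17.9) (TypedSection17,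
p412282): the same left-hand sides, with the printed error `o(𝔓)` read relative to the main-term scale,
`ε(𝔞+1)𝔓` — the reading TEAM A adopted for the family «size of `L′(1,χ)` / `𝔞` under (A)» (GAP rows
G-L4fam-1 / G-d58-1: below (17.9) sits the unprinted summed-error input `hE` of §17.u024, whose absolute
budget is the knife-edge `L′(1,χ) = o(𝓛²)` while the relative budget has room `~𝓛²`). Consumer: the
relative §17 edge `Phi3Eval.eval1710Rel_of_rel` (`Section17Eval1710Rel`), whose inline hypotheses these
definitions name, and the whole-DAG re-thread (cone pen). Same objects as `TypedSection17`
(`I4`, `finsetOf (PsiOne χ)`, `t0`, `beta3`, `alpha`, `frake0`, `frake`, `frakA`, `frakP`); nothing is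
restated. CLAIMS (readings), stated not asserted; nothing about Theorems 1–2 of the source is implied.

## References

* Y. Zhang, arXiv:2211.02515v1 (2022), §17 (17.6) p. 96 tex L4763, (17.9) p. 98 tex L4849.
  [cite: Zhang2022LandauSiegel, §17 (17.6), (17.9)]
-/

noncomputable section

open Complex Real

namespace Literature.NumberTheory.LFunctions.Zhang2022.Typed.Section17

open Literature.NumberTheory.LFunctions.Zhang2022
open Literature.NumberTheory.LFunctions.Zhang2022.Skeleton

variable (c' : ℝ)

/-- **(17.6)ᴿ — (17.6) in the relative reading** (§17 p. 96, tex L4763): "`Σ_{ψ∈Ψ₁}(p_ψt₀)^{β₃}I₄⁺(ψ) =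
−𝔢₀𝔞𝔓 + o(𝔓)`" with `o(𝔓)` read `ε(𝔞+1)𝔓` (family ruling D-G-L4fam-1; the printed-absolute form is
`Typed.Section17.Eq17_6`, which implies this one: `Phi3Eval.eq17_6Rel_of_eq17_6`). CLAIM (reading).
DAG `Z22:(17.6)`. [cite: Zhang2022LandauSiegel, §17 (17.6) p.96] -/
def Eq17_6Rel : Prop :=
  ∀ ε : ℝ, 0 < ε → ForAllLarge fun D _ χ => AssumptionA D χ →
    ‖(∑ x ∈ finsetOf (PsiOne χ), (((x.p : ℝ) * t0 D : ℝ) : ℂ) ^ beta3 c' D * I4 c' χ x (alpha D)) +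
        frake0 * frakA χ * frakP D‖ ≤ ε * (frakA χ + 1) * frakP D

/-- **(17.9)ᴿ — (17.9) in the relative reading** (§17 p. 98, tex L4849): "`Σ_{ψ∈Ψ₁}(p_ψt₀)^{β₃}I₄⁻(ψ) =
𝔢₁𝔞𝔓 + o(𝔓)`" with `o(𝔓)` read `ε(𝔞+1)𝔓` (family ruling D-G-L4fam-1; the printed-absolute form is
`Typed.Section17.Eq17_9`, which implies this one: `Phi3Eval.eq17_9Rel_of_eq17_9`). CLAIM (reading).
DAG `Z22:(17.9)`. [cite: Zhang2022LandauSiegel, §17 (17.9) p.98] -/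
def Eq17_9Rel : Prop :=
  ∀ ε : ℝ, 0 < ε → ForAllLarge fun D _ χ => AssumptionA D χ →
    ‖(∑ x ∈ finsetOf (PsiOne χ), (((x.p : ℝ) * t0 D : ℝ) : ℂ) ^ beta3 c' D * I4 c' χ x (-alpha D)) -
        frake 1 * frakA χ * frakP D‖ ≤ ε * (frakA χ + 1) * frakP D

/-- Unfolding lemma: `Eq17_6Rel c′` is literally the inline relative hypothesis of
`Phi3Eval.eval1710Rel_of_rel`. [cite: Zhang2022LandauSiegel, §17 (17.6) p.96] -/
theorem eq17_6Rel_iff : Eq17_6Rel c' ↔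
    ∀ ε : ℝ, 0 < ε → ForAllLarge fun D _ χ => AssumptionA D χ →
      ‖(∑ x ∈ finsetOf (PsiOne χ), (((x.p : ℝ) * t0 D : ℝ) : ℂ) ^ beta3 c' D * I4 c' χ x (alpha D)) +
          frake0 * frakA χ * frakP D‖ ≤ ε * (frakA χ + 1) * frakP D := Iff.rfl

/-- Unfolding lemma: `Eq17_9Rel c′` is literally the inline relative hypothesis of
`Phi3Eval.eval1710Rel_of_rel`. [cite: Zhang2022LandauSiegel, §17 (17.9) p.98] -/
theorem eq17_9Rel_iff : Eq17_9Rel c' ↔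
    ∀ ε : ℝ, 0 < ε → ForAllLarge fun D _ χ => AssumptionA D χ →
      ‖(∑ x ∈ finsetOf (PsiOne χ), (((x.p : ℝ) * t0 D : ℝ) : ℂ) ^ beta3 c' D * I4 c' χ x (-alpha D)) -
          frake 1 * frakA χ * frakP D‖ ≤ ε * (frakA χ + 1) * frakP D := Iff.rfl

end Literature.NumberTheory.LFunctions.Zhang2022.Typed.Section17
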